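import Mathlib.LinearAlgebra.CliffordAlgebra.Contraction
import Mathlib.RingTheory.Nilpotent.Exp
import Literature.MathematicalPhysics.QuantumLattice.GrassmannIntegral
import HarnessLib

/-!
# Grassmann derivatives, the fermionic Laplacian `Δ_C` and the Gaussian convolution semigroup

Topic `MathematicalPhysics/QuantumLattice`; generic layer under the definition request
`defn-hubbardEffectiveAction` (route HubbardSuperconductivity/AposterioriCapRg).  Salmhofer's
renormalization group for many-fermion systems is formulated on a finite-dimensional Grassmann
algebra `𝒜` generated by `(ψ(X))_{X ∈ Γ}`, `Γ` a finite set of field labels (time/frequency,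
momentum, spin, charge index): the Grassmann Gaussian "measure" `dμ_C` of an antisymmetric
covariance `C : Γ × Γ → R` acts on `𝒜` through the **fermionic Laplacian**
`Δ_C = ½ Σ_{X,X'} ∂/∂ψ(X) C(X,X') ∂/∂ψ(X')` (Salmhofer 1999, (4.86); Salmhofer 1998, Prop. 1):
the convolution `F ↦ ∫ dμ_C(χ) F(χ + ψ)` is the operator `e^{Δ_C}` (loc. cit. (4.88), (4.91)),
a finite sum since `Δ_C` is nilpotent, and covariances add under composition (the semigroup
property behind Wilson's effective action, Salmhofer 1999 §2.5.1 (2.105) and §4.3).  This file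
provides that operator calculus; the effective action itself is in
`GrassmannEffectiveAction.lean`, the Hubbard-model instance in `HubbardEffectiveAction.lean`.

## Contents (all statements are theorems; three definitions)

* `grassmannDeriv R X : 𝒜 →ₗ[R] 𝒜` — the left Grassmann derivative `∂/∂ψ(X)`, Mathlib's
  `CliffordAlgebra.contractLeft` by the coordinate form `ψ ↦ ψ(X)` (Berezin 1966, Ch. I §3);
  `grassmannDeriv_gen` (`∂_X θ_Y = δ_{XY}`), `grassmannDeriv_gen_mul` (graded Leibniz rule),
  `grassmannDeriv_algebraMap`, `grassmannDeriv_mul_self` (`∂_X² = 0`), `grassmannDeriv_mul_comm`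
  (`∂_X ∂_Y = -∂_Y ∂_X`).
* `grassmannLaplacian R C = ½ Σ_{X,Y} C X Y • ∂_X ∂_Y` (Salmhofer 1999, (4.86)); additive in `C`,
  pairwise commuting (`commute_grassmannLaplacian`), nilpotent (`isNilpotent_grassmannLaplacian`),
  `grassmannLaplacian_transpose` (`Δ_{Cᵀ} = -Δ_C`: only the antisymmetric part of `C` matters).
* `gaussConv R C = exp Δ_C` — the Gaussian convolution `μ_C ⋆ F = ∫ dμ_C(χ) F(χ + ·)`
  (Salmhofer 1999, Prop. 4.3, (4.88)); **semigroup / addition principle** `gaussConv_add`: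
  `μ_{C₁+C₂} ⋆ F = μ_{C₁} ⋆ (μ_{C₂} ⋆ F)` (loc. cit. (2.105)); `gaussConv_zero`, `gaussConv_one`
  (normalisation `∫ dμ_C = 1`), `gaussConv_algebraMap`, and the two-point convention
  `gaussConv_gen_mul_gen`: `μ_C ⋆ (θ_X θ_Y) = θ_X θ_Y + ½ (C Y X - C X Y)`, i.e. for antisymmetric
  `C` the "expectation" of `ψ(X)ψ(Y)` is `C(Y,X) = -C(X,Y)` (the sign forced by Salmhofer's
  characteristic function `∫ dμ_C e^{(η,ψ)} = e^{½(η,Cη)}`, (4.84)).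

## Sources

M. Salmhofer, *Renormalization: An Introduction* (Springer 1999), §4.3.1–4.3.2, (4.83)–(4.91),
Prop. 4.3 (PDF pp. 118–120 of the held copy `book:salmhofer1999-renormalization-introduction`),
§2.5.1 (2.105)–(2.106) (semigroup property); bib key `Salmhofer1999`.
M. Salmhofer, *Continuous renormalization for fermions and Fermi liquid theory*, Commun. Math.
Phys. 194 (1998) 249–295, §3.1, Prop. 1 (arXiv:cond-mat/9706188, p. 11 of the held text);
bib key `Salmhofer1998`.  F. A. Berezin, *The Method of Second Quantization* (1966), Ch. I §3
(left derivatives on the Grassmann algebra); bib key `Berezin1966`.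

## Design

* Everything is basis-free: only `[Fintype Γ] [DecidableEq Γ]` is assumed (no linear order),
  and `C` need NOT be invertible — cutoff covariances of a scale decomposition are singular,
  which is why the Laplacian form (4.88) rather than a Berezin integral against `e^{ψ̄C⁻¹ψ}`
  (`gaussOn`, `GrassmannGaussianExpectation.lean`) is taken as primitive.  The identification of
  `e^{Δ_C}` with the two-field integral `∫ dμ_C(χ) F(χ + ψ)` is Salmhofer's Prop. 4.3 and is not
  re-proved here.
* Salmhofer's weighted sums `∫_Γ dX = ε_Γ Σ_X` and `δ/δψ = ε_Γ⁻¹ ∂/∂ψ` cancel in `Δ_C`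
  ((4.86) with `C(X,X')` the kernel w.r.t. `∫ dX`), so plain sums and plain derivatives are used.
* `[Algebra ℚ R]` (as in `grassmannExp`) provides the `½` and Mathlib's `IsNilpotent.exp` on
  `Module.End R 𝒜`.
-/

noncomputable section

namespace Literature.MathematicalPhysics.QuantumLattice

section QLatticeAQFT

open GrassmannAlgebra

variable (R : Type*) [CommRing R] {Γ : Type*}

/-! ### Left derivatives `∂/∂ψ(X)` -/

/-- The **left Grassmann derivative** `∂/∂ψ(X)` on the Grassmann algebra with generators
`(ψ(Y))_{Y ∈ Γ}`: the contraction (interior product) by the coordinate functional `v ↦ v X`,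
Mathlib's `CliffordAlgebra.contractLeft` at quadratic form `0`.  It is the unique `R`-linear map
with `∂_X 1 = 0`, `∂_X (ψ(Y) a) = δ_{XY} a - ψ(Y) ∂_X a` (Berezin 1966, Ch. I §3; Salmhofer
1999, §4.3.1: "the fermionic derivatives anticommute"). [cite: Berezin1966, Ch. I §3] -/
def grassmannDeriv (X : Γ) : GrassmannAlgebra R Γ →ₗ[R] GrassmannAlgebra R Γ :=
  CliffordAlgebra.contractLeft (LinearMap.proj X : (Γ → R) →ₗ[R] R)

/-- `∂_X` on a degree-one element `ι v = Σ_Y v(Y) ψ(Y)` is the scalar `v X`. [folklore] -/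
theorem grassmannDeriv_ι (X : Γ) (v : Γ → R) :
    grassmannDeriv R X (ExteriorAlgebra.ι R v) = algebraMap R _ (v X) :=
  CliffordAlgebra.contractLeft_ι _ _ _

/-- `∂_X ψ(Y) = δ_{XY}` (Salmhofer 1998, §3: `δ/δψ(X) ψ(X') = δ(X,X')`). [folklore] -/
theorem grassmannDeriv_gen [DecidableEq Γ] (X Y : Γ) :
    grassmannDeriv R X (gen R Y) = if X = Y then 1 else 0 := by
  rw [gen, grassmannDeriv_ι]
  by_cases h : X = Y
  · subst h; simp
  · rw [Pi.single_eq_of_ne h, map_zero, if_neg h]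

/-- `∂_X` kills scalars. [folklore] -/
@[simp] theorem grassmannDeriv_algebraMap (X : Γ) (r : R) :
    grassmannDeriv R X (algebraMap R (GrassmannAlgebra R Γ) r) = 0 :=
  CliffordAlgebra.contractLeft_algebraMap _ _ _

/-- `∂_X 1 = 0`. [folklore] -/
@[simp] theorem grassmannDeriv_one (X : Γ) : grassmannDeriv R X (1 : GrassmannAlgebra R Γ) = 0 :=
  CliffordAlgebra.contractLeft_one _ _

/-- The **graded Leibniz rule** on a degree-one left factor:
`∂_X (ι v · a) = v(X) a - ι v · ∂_X a` (Berezin 1966, Ch. I §3). [folklore] -/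
theorem grassmannDeriv_ι_mul (X : Γ) (v : Γ → R) (a : GrassmannAlgebra R Γ) :
    grassmannDeriv R X (ExteriorAlgebra.ι R v * a) = v X • a - ExteriorAlgebra.ι R v * grassmannDeriv R X a :=
  CliffordAlgebra.contractLeft_ι_mul _ _ _

/-- The graded Leibniz rule on a generator: `∂_X (ψ(Y) a) = δ_{XY} a - ψ(Y) ∂_X a`. [folklore] -/
theorem grassmannDeriv_gen_mul [DecidableEq Γ] (X Y : Γ) (a : GrassmannAlgebra R Γ) :
    grassmannDeriv R X (gen R Y * a) = (if X = Y then a else 0) - gen R Y * grassmannDeriv R X a := by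
  rw [gen, grassmannDeriv_ι_mul]
  by_cases h : X = Y
  · subst h; simp
  · rw [Pi.single_eq_of_ne h, zero_smul, if_neg h]

/-- `∂_X (∂_X a) = 0` (Salmhofer 1999, §4.3.1). [folklore] -/
theorem grassmannDeriv_grassmannDeriv_self (X : Γ) (a : GrassmannAlgebra R Γ) :
    grassmannDeriv R X (grassmannDeriv R X a) = 0 :=
  CliffordAlgebra.contractLeft_contractLeft _ a

/-- **Fermionic derivatives anticommute**: `∂_X (∂_Y a) = -∂_Y (∂_X a)` (Salmhofer 1999,
§4.3.1). [folklore] -/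
theorem grassmannDeriv_grassmannDeriv_comm (X Y : Γ) (a : GrassmannAlgebra R Γ) :
    grassmannDeriv R X (grassmannDeriv R Y a) = -grassmannDeriv R Y (grassmannDeriv R X a) :=
  CliffordAlgebra.contractLeft_comm _ _ a

/-- `∂_X ∂_X = 0` as endomorphisms. [folklore] -/
theorem grassmannDeriv_mul_self (X : Γ) : grassmannDeriv R X * grassmannDeriv R X = 0 :=
  LinearMap.ext fun a => grassmannDeriv_grassmannDeriv_self R X a

/-- `∂_X ∂_Y = -∂_Y ∂_X` as endomorphisms. [folklore] -/
theorem grassmannDeriv_mul_comm (X Y : Γ) :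
    grassmannDeriv R X * grassmannDeriv R Y = -(grassmannDeriv R Y * grassmannDeriv R X) :=
  LinearMap.ext fun a => grassmannDeriv_grassmannDeriv_comm R X Y a

/-- Pairs of derivatives commute with pairs: `(∂_X∂_Y)(∂_U∂_V) = (∂_U∂_V)(∂_X∂_Y)` (four
transpositions). [folklore] -/
theorem commute_grassmannDeriv_mul_grassmannDeriv (X Y U V : Γ) :
    Commute (grassmannDeriv R X * grassmannDeriv R Y) (grassmannDeriv R U * grassmannDeriv R V) := by
  refine LinearMap.ext fun a => ?_
  simp only [Module.End.mul_apply]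
  rw [grassmannDeriv_grassmannDeriv_comm R Y U, map_neg, grassmannDeriv_grassmannDeriv_comm R X U,
    grassmannDeriv_grassmannDeriv_comm R Y V, map_neg, map_neg, grassmannDeriv_grassmannDeriv_comm R X V,
    map_neg, neg_neg, neg_neg]

/-- `(∂_X ∂_Y)² = 0`. [folklore] -/
theorem grassmannDeriv_mul_grassmannDeriv_mul_self (X Y : Γ) :
    grassmannDeriv R X * grassmannDeriv R Y * (grassmannDeriv R X * grassmannDeriv R Y) = 0 := by
  refine LinearMap.ext fun a => ?_
  simp only [Module.End.mul_apply, LinearMap.zero_apply]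
  rw [grassmannDeriv_grassmannDeriv_comm R Y X, map_neg, grassmannDeriv_grassmannDeriv_self, neg_zero]

/-- `∂_V (ψ(X)ψ(Y)) = δ_{VX} ψ(Y) - δ_{VY} ψ(X)`. [folklore] -/
theorem grassmannDeriv_gen_mul_gen [DecidableEq Γ] (V X Y : Γ) :
    grassmannDeriv R V (gen R X * gen R Y) = (if V = X then gen R Y else 0) - (if V = Y then gen R X else 0) := by
  rw [grassmannDeriv_gen_mul, grassmannDeriv_gen]
  split_ifs <;> simp

/-- `∂_U ∂_V (ψ(X)ψ(Y)) = δ_{VX}δ_{UY} - δ_{VY}δ_{UX}`. [folklore] -/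
theorem grassmannDeriv_grassmannDeriv_gen_mul_gen [DecidableEq Γ] (U V X Y : Γ) :
    grassmannDeriv R U (grassmannDeriv R V (gen R X * gen R Y)) =
      (if V = X then (if U = Y then 1 else 0) else 0) - (if V = Y then (if U = X then 1 else 0) else 0) := by
  rw [grassmannDeriv_gen_mul_gen, map_sub]
  simp only [apply_ite (grassmannDeriv R U), map_zero, grassmannDeriv_gen]

/-! ### The fermionic Laplacian `Δ_C` -/

variable [Fintype Γ] [Algebra ℚ R]

/-- The **fermionic Laplacian** of a covariance `C : Γ × Γ → R`,
`Δ_C = ½ Σ_{X,Y} C(X,Y) ∂/∂ψ(X) ∂/∂ψ(Y)` (Salmhofer 1999, (4.86); Salmhofer 1998, Prop. 1),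
an endomorphism of the Grassmann algebra lowering the degree by two.  Only the antisymmetric
part of `C` contributes (`grassmannLaplacian_transpose`). [cite: Salmhofer1999, §4.3.2 (4.86)] -/
def grassmannLaplacian (C : Matrix Γ Γ R) : Module.End R (GrassmannAlgebra R Γ) :=
  ((1 / 2 : ℚ) • (1 : R)) • ∑ X, ∑ Y, C X Y • (grassmannDeriv R X * grassmannDeriv R Y)

/-- Unfolding `grassmannLaplacian`. [folklore] -/
theorem grassmannLaplacian_apply (C : Matrix Γ Γ R) (a : GrassmannAlgebra R Γ) :
    grassmannLaplacian R C a =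
      ((1 / 2 : ℚ) • (1 : R)) • ∑ X, ∑ Y, C X Y • grassmannDeriv R X (grassmannDeriv R Y a) := by
  simp only [grassmannLaplacian, LinearMap.smul_apply, LinearMap.coe_sum, Finset.sum_apply,
    Module.End.mul_apply]

/-- `Δ_C` is additive in the covariance (the algebraic root of the semigroup property).
[folklore] -/
theorem grassmannLaplacian_add (C₁ C₂ : Matrix Γ Γ R) :
    grassmannLaplacian R (C₁ + C₂) = grassmannLaplacian R C₁ + grassmannLaplacian R C₂ := by
  simp only [grassmannLaplacian, Matrix.add_apply, add_smul, Finset.sum_add_distrib, smul_add]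

/-- `Δ_0 = 0`. [folklore] -/
@[simp] theorem grassmannLaplacian_zero : grassmannLaplacian R (0 : Matrix Γ Γ R) = 0 := by
  simp [grassmannLaplacian]

/-- `Δ` is homogeneous in the covariance. [folklore] -/
theorem grassmannLaplacian_smul (r : R) (C : Matrix Γ Γ R) :
    grassmannLaplacian R (r • C) = r • grassmannLaplacian R C := by
  simp only [grassmannLaplacian, Matrix.smul_apply, smul_eq_mul, mul_smul, ← Finset.smul_sum]
  rw [smul_comm]

/-- `Δ_{Cᵀ} = -Δ_C` (the derivatives anticommute), so `Δ_C` only depends on the antisymmetric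
part of `C`. [folklore] -/
theorem grassmannLaplacian_transpose (C : Matrix Γ Γ R) :
    grassmannLaplacian R C.transpose = -grassmannLaplacian R C := by
  refine LinearMap.ext fun a => ?_
  rw [LinearMap.neg_apply, grassmannLaplacian_apply, grassmannLaplacian_apply, ← smul_neg,
    ← Finset.sum_neg_distrib]
  conv_lhs => rw [Finset.sum_comm]
  congr 1
  refine Finset.sum_congr rfl fun Y _ => ?_
  rw [← Finset.sum_neg_distrib]
  refine Finset.sum_congr rfl fun X _ => ?_
  rw [Matrix.transpose_apply, grassmannDeriv_grassmannDeriv_comm R X Y, smul_neg]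

/-- **Laplacians commute**: `Δ_{C₁} Δ_{C₂} = Δ_{C₂} Δ_{C₁}` ("all differential operators are
bilinear, hence commute with one another", Salmhofer 1999, proof of Prop. 4.3). [folklore] -/
theorem commute_grassmannLaplacian (C₁ C₂ : Matrix Γ Γ R) :
    Commute (grassmannLaplacian R C₁) (grassmannLaplacian R C₂) := by
  unfold grassmannLaplacian
  refine ((Commute.sum_left _ _ _ fun X _ => Commute.sum_left _ _ _ fun Y _ =>
    Commute.sum_right _ _ _ fun U _ => Commute.sum_right _ _ _ fun V _ => ?_).smul_left _).smul_right _
  exact ((commute_grassmannDeriv_mul_grassmannDeriv R X Y U V).smul_left _).smul_right _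

/-- **`Δ_C` is nilpotent** (it lowers the degree by two; here: it is a sum of pairwise commuting
terms `C(X,Y) ∂_X∂_Y` of square zero). [folklore] -/
theorem isNilpotent_grassmannLaplacian (C : Matrix Γ Γ R) : IsNilpotent (grassmannLaplacian R C) := by
  unfold grassmannLaplacian
  refine IsNilpotent.smul (Commute.isNilpotent_sum (fun X _ => Commute.isNilpotent_sum
    (fun Y _ => ⟨2, ?_⟩) fun Y V _ _ => ?_) fun X U _ _ => ?_) _
  · rw [pow_two, smul_mul_smul_comm, grassmannDeriv_mul_grassmannDeriv_mul_self, smul_zero]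
  · exact ((commute_grassmannDeriv_mul_grassmannDeriv R X Y X V).smul_left _).smul_right _
  · exact Commute.sum_left _ _ _ fun Y _ => Commute.sum_right _ _ _ fun V _ =>
      ((commute_grassmannDeriv_mul_grassmannDeriv R X Y U V).smul_left _).smul_right _

/-- `Δ_C` kills scalars. [folklore] -/
@[simp] theorem grassmannLaplacian_algebraMap (C : Matrix Γ Γ R) (r : R) :
    grassmannLaplacian R C (algebraMap R (GrassmannAlgebra R Γ) r) = 0 := by
  simp [grassmannLaplacian_apply]

/-- `Δ_C 1 = 0`. [folklore] -/
@[simp] theorem grassmannLaplacian_one (C : Matrix Γ Γ R) :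
    grassmannLaplacian R C (1 : GrassmannAlgebra R Γ) = 0 := by
  simp [grassmannLaplacian_apply]

/-- `Δ_C` on a product of two generators: `Δ_C (ψ(X)ψ(Y)) = ½ (C(Y,X) - C(X,Y))`. [folklore] -/
theorem grassmannLaplacian_gen_mul_gen [DecidableEq Γ] (C : Matrix Γ Γ R) (X Y : Γ) :
    grassmannLaplacian R C (gen R X * gen R Y) =
      algebraMap R _ (((1 / 2 : ℚ) • (1 : R)) * (C Y X - C X Y)) := by
  rw [grassmannLaplacian_apply]
  simp only [grassmannDeriv_grassmannDeriv_gen_mul_gen, smul_sub, smul_ite, smul_zero,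
    Finset.sum_sub_distrib, Finset.sum_ite_eq', Finset.mem_univ, if_true]
  rw [Algebra.algebraMap_eq_smul_one, ← smul_smul, ← smul_sub, ← sub_smul]

/-! ### The Gaussian convolution semigroup `e^{Δ_C}` -/

/-- The **Gaussian convolution** by the Grassmann Gaussian measure of covariance `C`:
`μ_C ⋆ F = ∫ dμ_C(χ) F(χ + ψ) = e^{Δ_C} F` (Salmhofer 1999, Prop. 4.3, (4.88):
`e^{𝒢(t,ψ)} = e^{Δ_{C_t}} e^{𝒢(0,ψ)}`; Salmhofer 1998, Prop. 1), a finite exponential sum since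
`Δ_C` is nilpotent (`IsNilpotent.exp`).  Defined for every `C` (no invertibility or antisymmetry
needed; only the antisymmetric part of `C` matters). [cite: Salmhofer1999, Prop. 4.3 (4.88)] -/
def gaussConv (C : Matrix Γ Γ R) : Module.End R (GrassmannAlgebra R Γ) :=
  IsNilpotent.exp (grassmannLaplacian R C)

/-- Unfolding `gaussConv`. [folklore] -/
theorem gaussConv_def (C : Matrix Γ Γ R) : gaussConv R C = IsNilpotent.exp (grassmannLaplacian R C) :=
  rfl

/-- No fields to integrate: `μ_0 ⋆ F = F`. [folklore] -/
@[simp] theorem gaussConv_zero : gaussConv R (0 : Matrix Γ Γ R) = 1 := by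
  rw [gaussConv, grassmannLaplacian_zero, IsNilpotent.exp_zero]

/-- **The semigroup property / addition principle**: covariances add under composition of the
Gaussian convolutions, `μ_{C₁ + C₂} ⋆ F = μ_{C₁} ⋆ (μ_{C₂} ⋆ F)`, i.e.
`e^{Δ_{C₁+C₂}} = e^{Δ_{C₁}} e^{Δ_{C₂}}` (Salmhofer 1999, §2.5.1 (2.105) and Prop. 4.3;
Benfatto–Giuliani–Mastropietro 2006, (2.12)). [cite: Salmhofer1999, §2.5.1 (2.105)] -/
theorem gaussConv_add (C₁ C₂ : Matrix Γ Γ R) :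
    gaussConv R (C₁ + C₂) = gaussConv R C₁ * gaussConv R C₂ := by
  rw [gaussConv, grassmannLaplacian_add, IsNilpotent.exp_add_of_commute (commute_grassmannLaplacian R C₁ C₂)
    (isNilpotent_grassmannLaplacian R C₁) (isNilpotent_grassmannLaplacian R C₂), gaussConv, gaussConv]

/-- … pointwise: `μ_{C₁+C₂} ⋆ F = μ_{C₁} ⋆ (μ_{C₂} ⋆ F)`. [cite: Salmhofer1999, §2.5.1 (2.105)] -/
theorem gaussConv_add_apply (C₁ C₂ : Matrix Γ Γ R) (F : GrassmannAlgebra R Γ) :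
    gaussConv R (C₁ + C₂) F = gaussConv R C₁ (gaussConv R C₂ F) := by
  rw [gaussConv_add, Module.End.mul_apply]

/-- The Gaussian convolutions of two covariances commute. [folklore] -/
theorem gaussConv_comm (C₁ C₂ : Matrix Γ Γ R) :
    gaussConv R C₁ * gaussConv R C₂ = gaussConv R C₂ * gaussConv R C₁ := by
  rw [← gaussConv_add, add_comm, gaussConv_add]

/-- `μ_C ⋆` is invertible with inverse `μ_{-C} ⋆`. [folklore] -/
theorem gaussConv_neg_mul (C : Matrix Γ Γ R) : gaussConv R (-C) * gaussConv R C = 1 := by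
  rw [← gaussConv_add, neg_add_cancel, gaussConv_zero]

omit [Fintype Γ] in
/-- A nilpotent exponential fixes the vectors killed by its exponent. [folklore] -/
theorem exp_apply_eq_self_of_apply_eq_zero {T : Module.End R (GrassmannAlgebra R Γ)}
    (hT : IsNilpotent T) {a : GrassmannAlgebra R Γ} (ha : T a = 0) : IsNilpotent.exp T a = a := by
  obtain ⟨k, hk⟩ := hT
  rw [IsNilpotent.exp_eq_sum hk, LinearMap.coe_sum, Finset.sum_apply]
  rcases Nat.eq_zero_or_pos k with rfl | hkpos
  · -- `T ^ 0 = 1 = 0`: the endomorphism ring is trivial, so is the algebra element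
    have h1 : (1 : Module.End R (GrassmannAlgebra R Γ)) = 0 := by rw [← pow_zero T, hk]
    have : a = 0 := by simpa using congrArg (fun f => f a) h1
    simp [this]
  rw [Finset.sum_eq_single_of_mem 0 (Finset.mem_range.2 hkpos)]
  · simp
  · intro i _ hi
    obtain ⟨j, rfl⟩ := Nat.exists_eq_succ_of_ne_zero hi
    rw [LinearMap.smul_apply, pow_succ, Module.End.mul_apply, ha, map_zero, smul_zero]

/-- **Normalisation** `∫ dμ_C = 1`: `μ_C ⋆ 1 = 1` (Salmhofer 1999, after (4.84)). [folklore] -/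
@[simp] theorem gaussConv_one (C : Matrix Γ Γ R) : gaussConv R C (1 : GrassmannAlgebra R Γ) = 1 :=
  exp_apply_eq_self_of_apply_eq_zero R (isNilpotent_grassmannLaplacian R C) (grassmannLaplacian_one R C)

/-- `μ_C ⋆` fixes scalars. [folklore] -/
@[simp] theorem gaussConv_algebraMap (C : Matrix Γ Γ R) (r : R) :
    gaussConv R C (algebraMap R (GrassmannAlgebra R Γ) r) = algebraMap R _ r :=
  exp_apply_eq_self_of_apply_eq_zero R (isNilpotent_grassmannLaplacian R C) (grassmannLaplacian_algebraMap R C r)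

/-- **The two-point convention.** `μ_C ⋆ (ψ(X)ψ(Y)) = ψ(X)ψ(Y) + ½ (C(Y,X) - C(X,Y))`; for an
antisymmetric covariance the Gaussian expectation of `ψ(X)ψ(Y)` is therefore `C(Y,X) = -C(X,Y)`
— the convention forced by the characteristic function `∫ dμ_C e^{(η,ψ)} = e^{½(η,Cη)}`
(Salmhofer 1999, (4.84); compare `grassmannGaussian_twoPoint`: `⟨ψ̄ᵣψ_c⟩_{e^{ψ̄Aψ}} = (A⁻¹)_{cr}`).
[folklore] -/
theorem gaussConv_gen_mul_gen [DecidableEq Γ] (C : Matrix Γ Γ R) (X Y : Γ) :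
    gaussConv R C (gen R X * gen R Y) =
      gen R X * gen R Y + algebraMap R _ (((1 / 2 : ℚ) • (1 : R)) * (C Y X - C X Y)) := by
  have hΔ := grassmannLaplacian_gen_mul_gen R C X Y
  have hΔ2 : (grassmannLaplacian R C ^ 2) (gen R X * gen R Y) = 0 := by
    rw [pow_two, Module.End.mul_apply, hΔ, grassmannLaplacian_algebraMap]
  -- `exp Δ = 1 + Δ + (terms Δ^{k+2})`, and `Δ^{k+2}` kills `θ_X θ_Y`
  obtain ⟨k, hk⟩ := isNilpotent_grassmannLaplacian R C
  have hk2 : grassmannLaplacian R C ^ (k + 2) = 0 := by rw [pow_add, hk, zero_mul]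
  rw [gaussConv, IsNilpotent.exp_eq_sum hk2, LinearMap.coe_sum, Finset.sum_apply,
    Finset.sum_range_succ', Finset.sum_range_succ']
  have hvan : ∑ i ∈ Finset.range k, (((i + 1 + 1).factorial : ℚ)⁻¹ •
      grassmannLaplacian R C ^ (i + 1 + 1)) (gen R X * gen R Y) = 0 := by
    refine Finset.sum_eq_zero fun i _ => ?_
    rw [LinearMap.smul_apply, show i + 1 + 1 = i + 2 by ring, pow_add, Module.End.mul_apply, hΔ2,
      map_zero, smul_zero]
  rw [hvan, zero_add]
  simp [hΔ, add_comm]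

end QLatticeAQFT

end Literature.MathematicalPhysics.QuantumLattice
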